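/-
Copyright (c) 2026 the pub-hodgecm-mathlib formalisation cell (harness21).  Prover seat hodgecm-mathlib-K2E3-p05 (g0), Track B «K2-LIT»,
engine E3 «EllipticInputs», unit U4 «Keys», 2026-09-03.  KERNEL module: THEOREMS ONLY (no definition, no named fact, no `sorry`,
no instance, no notation).
-/
import Summits.HodgeConjecture.HodgeConjecture.Theorems.F0P3ReducibleOfIntertwiningCompositionZero  -- ★ `cmPrincipalSeries_reducible_of_forall_comp_eq_zero` (all compositions vanish ⇒ reducible; hypothesis-free)
import Summits.HodgeConjecture.HodgeConjecture.Theorems.F0P3cStCharTSPSIrredRegular                  -- ★ Bruhat: `cmWeylTorusCharPair_eq_of_ne_bot_ne_top` (reducible UNITARY `i_G(χ)` is `w`-fixed)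
import HarnessLib

/-!
# K2 ∕ E3 «EllipticInputs», unit U4 «Keys» — socket #5 `sig_K2E3CompZeroKeysListRegular` REDUCED TO THE PRINTED THEOREM
# [Keys1984, §7 Theorem (2)]: «all compositions `i_G(χ) → i_G(wχ) → i_G(χ)` vanish (χ regular) ⇒ `χ₁ ∈` Keys' list (1) ∪ (2)»
# follows from «a REDUCIBLE NON-UNITARY `i_G(χ₁, χ₂)` has `χ₁ ∈` list (1) ∪ (2)»; the unitary half is proved here in house

Cell hodgecm-mathlib (D-0151), FLOOR 0, Track B «K2-LIT» (21-frontier RULING «PUSH BOTH», REQUESTS l.72341), engine E3, crux item H413 =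
stmt-HodgeConjecture-24833 (route `HCCMUnconditional`, no route verbs); tier-1 socket module `Cruxes/H413/Lines/K2_E3_EllipticInputsSigs_U4Keys.lean`
(sha16 fb4ac27b21583d86), SIGS-TABLE-K2E3 row #5 (U4-b, XL).  Author K2E3-p05 (g0).  `--supports stmt-HodgeConjecture-24833 --as helper`; THEOREMS ONLY.

THE MATHEMATICS.  `G = U(Φ₃)(L⁺_v)`, `v` NON-SPLIT in the CM field `L`, `χ = (χ₁, χ₂)` a continuous character of the diagonal torus
(★ `cmTorusCharPair L v χ₁ χ₂`), `wχ = (χ̄₁⁻¹, χ₂)` (★ `cmTorusCharPair L v (conjInvChar σ χ₁) χ₂` = ★ `cmWeylTorusCharPair L v χ₁ χ₂`, `rfl`),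
`χ` REGULAR (`wχ ≠ χ`).  Socket #5 asks: if EVERY composition `B ∘ A` of `G`-maps `A : i_G(χ) → i_G(wχ)`, `B : i_G(wχ) → i_G(χ)` is zero, then
`χ₁ = ‖·‖_E^{±1}` (list (1)) or `χ₁ = η‖·‖_E^{±1/2}` with `η|_{F^×} = ω_{E/F}` (list (2)) [Rogawski1990, §12.2 (1)–(2) p. 173; Keys1984, §7].
* Step 1 (★, [Casselman1995, Thm. 6.6.2] easy direction, hypothesis-free in the tree): all compositions vanish ⇒ `i_G(χ)` has a `G`-stable
  `⊥ ≠ N ≠ ⊤` (★ `F0P3ReducibleOfIntertwiningCompositionZero.cmPrincipalSeries_reducible_of_forall_comp_eq_zero`).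
* Step 2 (★ Bruhat, [Casselman1995, Thm. 6.6.1]): if `χ₁` is UNITARY (`|χ₁| = 1`), a reducible `i_G(χ₁, χ₂)` is `w`-FIXED
  (★ `F0P3cStCharTSPSIrredRegular.cmWeylTorusCharPair_eq_of_ne_bot_ne_top`) — contradicting regularity: the unitary case of socket #5 holds.
* Step 3 (PRINT, the ONE remaining input, taken as a HYPOTHESIS spelled in the organ's vocabulary): [Keys1984, §7 Theorem (2)] = [Rogawski1990,
  §12.2 (1)–(2)]: «Suppose `λ ∈ (E^×)^` and `Re s > 0`.  The reducible non-unitary principal series `Ind_P^G λ_s` are the following: (E/F unramified)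
  (a) the unramified `λ_s = |·|_E^s` for `s = 1` or `s = ½ + πi(2 ln q)⁻¹`; (b) `λ` ramified, `λ|_{F^×} = 1`, `s = ½ + πi(2 ln q)⁻¹`; (E/F ramified)
  (c) unramified `λ_s = |·|_E^s`, `s = 1`; (d) `λ` ramified, `λ|_{𝒪_F^×}` of order 2, `s = ½`» — i.e. (`|x|_E = |x|_F²` on `F^×`, `w(λ_s) = λ̄⁻¹_{-s}`)
  a REDUCIBLE `i_G(χ₁, χ₂)` with `χ₁` NOT unitary has `χ₁ ∈` list (1) ∪ (2), for every `χ₂`.  (Keys computes the `c`-functions `γ_m(λ, s)` of `SU(3)`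
  through Tate's local `γ`-factors, §5 Theorem (2) (a)–(g), and reads reducibility off their zeros via [Casselman1995, Thm. 6.6.2]; none of this
  rank-one harmonic analysis is in the tree — SIGS-TABLE-K2E3 row #5 «TO BUILD: rank-one intertwining integral over the Heisenberg radical,
  meromorphic continuation, local Tate γ-factor (Mathlib: none)».)
So: **socket #5 ⟸ [Keys1984 §7 Thm (2)] VERBATIM (non-unitary reducibility points), everything else ★.**  Conversely [Keys1984 §7 Thm (2)] ⟸ sockets
#4 (`sig_K2E3PSRegularReducibleCompZero`, Casselman ⇒) + #5, since a non-unitary `χ₁` is regular — so this file loses nothing of the U4 plan; it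
identifies the analytic residue of row #5 with the printed statement and pays its unitary half.

* §1 `compZeroKeysListRegular_at_of_keysThmTwo_at` — ONE character: the socket's implication at `(L, v, χ₁, χ₂)` from Keys' Theorem (2) AT
  `(L, v, χ₁, χ₂)` (hypothesis `hK`: «`χ₁` not unitary ⇒ `i_G(χ₁, χ₂)` reducible ⇒ list (1) ∪ (2)», conclusion bytes = the socket's).
* §2 `compZeroKeysListRegular_of_keysThmTwo` — the socket's statement VERBATIM (binder telescope of `sig_K2E3CompZeroKeysListRegular`, the Lines-side
  `abbrev Pl L := HeightOneSpectrum (𝓞 L⁺)` inlined) from Keys' Theorem (2) quantified the same way.  Tie probe (home, imports the socket module):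
  `example (hK : …) : type_of% @…U4Keys.sig_K2E3CompZeroKeysListRegular := compZeroKeysListRegular_of_keysThmTwo hK` elaborates.
HONEST LABEL: HC_CM is proved only modulo the 7 printed citations (2 remaining named inputs: hLiu418 = stmt-HodgeConjecture-24832, h413 =
stmt-HodgeConjecture-24833) until rung 0 closes; this file discharges no printed citation — socket #5 stays OPEN; its residue is exactly
[Keys1984, §7 Thm (2)], taken here as a hypothesis, never as an axiom.

## References
* [Keys1984] D. Keys, *Principal series representations of special unitary groups over local fields*, Compositio Math. 51 (1984) 115–130:
  §7 Theorem (1)–(2) p. 126; §5 Theorem (2) (a)–(g) pp. 124–125; §3 (intertwining operators `A(w, λ)`).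
* [Rogawski1990] J. D. Rogawski, *Automorphic Representations of Unitary Groups in Three Variables*, Ann. of Math. Stud. 123 (1990), §12.1
  p. 171; §12.2 (1)–(3) p. 173.
* [Casselman1995] W. Casselman, *Introduction to the theory of admissible representations of p-adic reductive groups* (draft 1995), §6.4
  Prop. 6.4.1, §6.6 Thm. 6.6.1 (Bruhat), Thm. 6.6.2.
* [BernsteinZelevinsky1977] I. N. Bernstein, A. V. Zelevinsky, Ann. Sci. ÉNS 10 (1977), Thm. 2.9.
-/

set_option autoImplicit false
-- the mandated namespace has the single-problem summit's repeated segment (`HodgeConjecture.HodgeConjecture`)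
set_option linter.dupNamespace false

noncomputable section

open NumberField IsDedekindDomain MeasureTheory
open scoped Matrix MatrixGroups NNReal
open Literature.NumberTheory.Automorphic Literature.NumberTheory.Automorphic.UnitaryGroup

namespace Summit.HodgeConjecture.HodgeConjecture.Cruxes.H413.K2E3CompZeroKeysListRegularOfKeysThmTwo

/-! ## §1 One character: socket #5 at `(L, v, χ₁, χ₂)` from Keys' Theorem (2) at `(L, v, χ₁, χ₂)` -/

section At

variable (L : Type) [Field L] [NumberField L] [IsCMField L] (v : HeightOneSpectrum (𝓞 ↥(maximalRealSubfield L)))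

set_option synthInstance.maxHeartbeats 400000 in
set_option maxHeartbeats 1600000 in
-- statement-heavy: the `SmoothInd` carrier of `cmPrincipalSeries` (same budget as the socket module)
/-- **Socket #5 at one character, from [Keys1984, §7 Thm (2)] at that character.**  `v` non-split, `χ₁, χ₂` continuous, `χ = (χ₁, χ₂)` regular
(`χ ≠ wχ`).  Hypothesis `hK` = Keys' Theorem (2) ∕ [Rogawski1990 §12.2 (1)–(2)] for THIS `(χ₁, χ₂)`: if `χ₁` is not unitary and `i_G(χ₁, χ₂)` has a
`G`-stable `⊥ ≠ N ≠ ⊤`, then `χ₁ = ‖·‖^{±1}` or `χ₁ = η‖·‖^{±1/2}` with `η|_{F^×} = ω_{E/F}` (★ `halfModulusChar`, ★ `IsQuadraticCharExtension`; the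
disjuncts are the socket's bytes).  Conclusion: if every composition `B ∘ A`, `A : i_G(χ) → i_G(wχ)`, `B : i_G(wχ) → i_G(χ)`, vanishes then `χ₁` is on
that list.  Proof: ★ Step 1 gives `⊥ ≠ N ≠ ⊤`; if `|χ₁| = 1`, ★ Bruhat gives `wχ = χ`, absurd; else `hK`.
[cite: Keys1984, §7 Theorem (2) p. 126] [cite: Rogawski1990, §12.2 (1)–(2) p. 173] [cite: Casselman1995, Thm. 6.6.1, Thm. 6.6.2] -/
theorem compZeroKeysListRegular_at_of_keysThmTwo_at
    (hns : ∀ w : PlacesOver L v, IsCMField.complexConj L • w.1 = w.1)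
    (χ₁ : (UnitaryGroup.LocalRing L v)ˣ →* ℂˣ) (χ₂ : ↥(normOneUnits (conjLocal L (IsCMField.complexConj L) v)) →* ℂˣ)
    (h₁ : Continuous (fun x => ((χ₁ x : ℂˣ) : ℂ))) (h₂ : Continuous (fun x => ((χ₂ x : ℂˣ) : ℂ)))
    (hreg : UnitaryGroup.cmTorusCharPair L v χ₁ χ₂ ≠
      UnitaryGroup.cmTorusCharPair L v (UnitaryGroup.conjInvChar (conjLocal L (IsCMField.complexConj L) v) χ₁) χ₂)
    (hK : (∃ x, ‖((χ₁ x : ℂˣ) : ℂ)‖ ≠ 1) →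
      (∃ N : Subrepresentation (UnitaryGroup.cmPrincipalSeries L 3 v (UnitaryGroup.cmTorusCharPair L v χ₁ χ₂)), N ≠ ⊥ ∧ N ≠ ⊤) →
      (χ₁ = halfModulusChar (UnitaryGroup.LocalRing L v) * halfModulusChar (UnitaryGroup.LocalRing L v) ∨
        χ₁ = (halfModulusChar (UnitaryGroup.LocalRing L v) * halfModulusChar (UnitaryGroup.LocalRing L v))⁻¹) ∨
      (∃ η : (UnitaryGroup.LocalRing L v)ˣ →* ℂˣ, IsQuadraticCharExtension (conjLocal L (IsCMField.complexConj L) v) η ∧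
        Continuous (fun x => ((η x : ℂˣ) : ℂ)) ∧
        (χ₁ = η * halfModulusChar (UnitaryGroup.LocalRing L v) ∨ χ₁ = η * (halfModulusChar (UnitaryGroup.LocalRing L v))⁻¹)))
    (h0 : ∀ (A : (UnitaryGroup.cmPrincipalSeries L 3 v (UnitaryGroup.cmTorusCharPair L v χ₁ χ₂)).IntertwiningMap
          (UnitaryGroup.cmPrincipalSeries L 3 v (UnitaryGroup.cmTorusCharPair L v
            (UnitaryGroup.conjInvChar (conjLocal L (IsCMField.complexConj L) v) χ₁) χ₂)))
        (B : (UnitaryGroup.cmPrincipalSeries L 3 v (UnitaryGroup.cmTorusCharPair L v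
            (UnitaryGroup.conjInvChar (conjLocal L (IsCMField.complexConj L) v) χ₁) χ₂)).IntertwiningMap
          (UnitaryGroup.cmPrincipalSeries L 3 v (UnitaryGroup.cmTorusCharPair L v χ₁ χ₂))), B.comp A = 0) :
    (χ₁ = halfModulusChar (UnitaryGroup.LocalRing L v) * halfModulusChar (UnitaryGroup.LocalRing L v) ∨
      χ₁ = (halfModulusChar (UnitaryGroup.LocalRing L v) * halfModulusChar (UnitaryGroup.LocalRing L v))⁻¹) ∨
    (∃ η : (UnitaryGroup.LocalRing L v)ˣ →* ℂˣ, IsQuadraticCharExtension (conjLocal L (IsCMField.complexConj L) v) η ∧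
      Continuous (fun x => ((η x : ℂˣ) : ℂ)) ∧
      (χ₁ = η * halfModulusChar (UnitaryGroup.LocalRing L v) ∨ χ₁ = η * (halfModulusChar (UnitaryGroup.LocalRing L v))⁻¹)) := by
  -- Step 1 (★): all compositions vanish ⇒ `i_G(χ)` is reducible
  have hred : ∃ N : Subrepresentation (UnitaryGroup.cmPrincipalSeries L 3 v (UnitaryGroup.cmTorusCharPair L v χ₁ χ₂)), N ≠ ⊥ ∧ N ≠ ⊤ :=
    F0P3ReducibleOfIntertwiningCompositionZero.cmPrincipalSeries_reducible_of_forall_comp_eq_zero L v hns χ₁ χ₂ h₁ h₂ hreg h0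
  by_cases hu : ∀ x, ‖((χ₁ x : ℂˣ) : ℂ)‖ = 1
  · -- Step 2 (★ Bruhat): a reducible UNITARY `i_G(χ)` is `w`-fixed — contradicting regularity
    have hw : UnitaryGroup.cmWeylTorusCharPair L v χ₁ χ₂ = UnitaryGroup.cmTorusCharPair L v χ₁ χ₂ :=
      F0P3cStCharTSPSIrredRegular.cmWeylTorusCharPair_eq_of_ne_bot_ne_top L v hns χ₁ χ₂ h₁ h₂ hu hred
    exact absurd ((UnitaryGroup.cmWeylTorusCharPair_eq L v χ₁ χ₂).symm.trans hw).symm hreg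
  · -- Step 3 (PRINT [Keys1984 §7 Thm (2)], the hypothesis): the non-unitary reducibility points
    push Not at hu
    exact hK hu hred

end At

/-! ## §2 The socket's statement verbatim, from Keys' Theorem (2) quantified the same way -/

set_option synthInstance.maxHeartbeats 400000 in
set_option maxHeartbeats 1600000 in
-- statement-heavy: the `SmoothInd` carrier of `cmPrincipalSeries` (same budget as the socket module)
/-- **Socket #5 `sig_K2E3CompZeroKeysListRegular` FROM [Keys1984, §7 Theorem (2)].**  The conclusion is the socket's statement BYTES (Lines-side
`abbrev Pl L := HeightOneSpectrum (𝓞 L⁺)` inlined): for every CM field `L`, every finite place `v` of `L⁺` non-split in `L`, all continuous `χ₁, χ₂` with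
`χ = (χ₁, χ₂)` regular, the vanishing of every composition `i_G(χ) → i_G(wχ) → i_G(χ)` puts `χ₁` on Keys' list (1) ∪ (2) [Rogawski1990 §12.2].  The
hypothesis `hK` is Keys' printed Theorem (2) («Suppose `λ ∈ (E^×)^` and `Re s > 0`.  The reducible non-unitary principal series `Ind_P^G λ_s` are the
following: (a) … (d)», read through `|x|_E = |x|_F²` on `F^×` as `χ₁ ∈ {‖·‖^{±1}} ∪ {η‖·‖^{±1/2} : η|_{F^×} = ω_{E/F}}`) quantified over the same
telescope: a REDUCIBLE `i_G(χ₁, χ₂)` with `χ₁` NOT unitary has `χ₁` on list (1) ∪ (2).  §1 at each character.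
[cite: Keys1984, §7 Theorem (2) p. 126] [cite: Rogawski1990, §12.2 (1)–(2) p. 173] [cite: Casselman1995, Thm. 6.6.1, Thm. 6.6.2] -/
theorem compZeroKeysListRegular_of_keysThmTwo
    (hK : ∀ (L : Type) [Field L] [NumberField L] [IsCMField L] (v : HeightOneSpectrum (𝓞 ↥(maximalRealSubfield L))),
      (∀ w : PlacesOver L v, IsCMField.complexConj L • w.1 = w.1) →
      ∀ (χ₁ : (UnitaryGroup.LocalRing L v)ˣ →* ℂˣ) (χ₂ : ↥(normOneUnits (conjLocal L (IsCMField.complexConj L) v)) →* ℂˣ),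
        Continuous (fun x => ((χ₁ x : ℂˣ) : ℂ)) → Continuous (fun x => ((χ₂ x : ℂˣ) : ℂ)) → (∃ x, ‖((χ₁ x : ℂˣ) : ℂ)‖ ≠ 1) →
        (∃ N : Subrepresentation (UnitaryGroup.cmPrincipalSeries L 3 v (UnitaryGroup.cmTorusCharPair L v χ₁ χ₂)), N ≠ ⊥ ∧ N ≠ ⊤) →
        (χ₁ = halfModulusChar (UnitaryGroup.LocalRing L v) * halfModulusChar (UnitaryGroup.LocalRing L v) ∨
          χ₁ = (halfModulusChar (UnitaryGroup.LocalRing L v) * halfModulusChar (UnitaryGroup.LocalRing L v))⁻¹) ∨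
        (∃ η : (UnitaryGroup.LocalRing L v)ˣ →* ℂˣ, IsQuadraticCharExtension (conjLocal L (IsCMField.complexConj L) v) η ∧
          Continuous (fun x => ((η x : ℂˣ) : ℂ)) ∧
          (χ₁ = η * halfModulusChar (UnitaryGroup.LocalRing L v) ∨ χ₁ = η * (halfModulusChar (UnitaryGroup.LocalRing L v))⁻¹))) :
  ∀ (L : Type) [Field L] [NumberField L] [IsCMField L] (v : HeightOneSpectrum (𝓞 ↥(maximalRealSubfield L))),
    (∀ w : PlacesOver L v, IsCMField.complexConj L • w.1 = w.1) →
    ∀ (χ₁ : (UnitaryGroup.LocalRing L v)ˣ →* ℂˣ) (χ₂ : ↥(normOneUnits (conjLocal L (IsCMField.complexConj L) v)) →* ℂˣ), Continuous (fun x => ((χ₁ x : ℂˣ) : ℂ)) → Continuous (fun x => ((χ₂ x : ℂˣ) : ℂ)) → UnitaryGroup.cmTorusCharPair L v χ₁ χ₂ ≠ UnitaryGroup.cmTorusCharPair L v (UnitaryGroup.conjInvChar (conjLocal L (IsCMField.complexConj L) v) χ₁) χ₂ →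
      (∀ (A : (UnitaryGroup.cmPrincipalSeries L 3 v (UnitaryGroup.cmTorusCharPair L v χ₁ χ₂)).IntertwiningMap (UnitaryGroup.cmPrincipalSeries L 3 v (UnitaryGroup.cmTorusCharPair L v (UnitaryGroup.conjInvChar (conjLocal L (IsCMField.complexConj L) v) χ₁) χ₂))) (B : (UnitaryGroup.cmPrincipalSeries L 3 v (UnitaryGroup.cmTorusCharPair L v (UnitaryGroup.conjInvChar (conjLocal L (IsCMField.complexConj L) v) χ₁) χ₂)).IntertwiningMap (UnitaryGroup.cmPrincipalSeries L 3 v (UnitaryGroup.cmTorusCharPair L v χ₁ χ₂))), B.comp A = 0) →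
      (χ₁ = halfModulusChar (UnitaryGroup.LocalRing L v) * halfModulusChar (UnitaryGroup.LocalRing L v) ∨ χ₁ = (halfModulusChar (UnitaryGroup.LocalRing L v) * halfModulusChar (UnitaryGroup.LocalRing L v))⁻¹) ∨ (∃ η : (UnitaryGroup.LocalRing L v)ˣ →* ℂˣ, IsQuadraticCharExtension (conjLocal L (IsCMField.complexConj L) v) η ∧ Continuous (fun x => ((η x : ℂˣ) : ℂ)) ∧ (χ₁ = η * halfModulusChar (UnitaryGroup.LocalRing L v) ∨ χ₁ = η * (halfModulusChar (UnitaryGroup.LocalRing L v))⁻¹)) := by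
  intro L _ _ _ v hns χ₁ χ₂ h₁ h₂ hreg h0
  exact compZeroKeysListRegular_at_of_keysThmTwo_at L v hns χ₁ χ₂ h₁ h₂ hreg (hK L v hns χ₁ χ₂ h₁ h₂) h0

end Summit.HodgeConjecture.HodgeConjecture.Cruxes.H413.K2E3CompZeroKeysListRegularOfKeysThmTwo

end
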